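import Literature.NumberTheory.Sieve.VinogradovExpSum
import Literature.NumberTheory.Sieve.GoldbachLinnikCounts
import Mathlib.NumberTheory.Chebyshev
import Mathlib.NumberTheory.DiophantineApproximation.Basic
import HarnessLib

/-!
# Vinogradov's bound for the unweighted prime exponential sum `∑_{p ≤ N} e(pα)`

Topic `Literature/NumberTheory/Sieve`; a corollary file of `VinogradovExpSum.lean`, where
Vinogradov's theorem (Nathanson, *Additive Number Theory: The Classical Bases*, Thm 8.5; Vaughan's
proof) is PROVED for the log-weighted sum `T_N(α) = ∑_{p ≤ N} (log p) e(pα)`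
(`Literature.NumberTheory.Sieve.Vinogradov.vinogradov_primeExpSumLog_bound`:
`‖T_N(α)‖ ≤ C (N/√q + N^{4/5} + √N√q) log⁴ N` for `|α - a/q| ≤ q⁻²`, `(a, q) = 1`, `1 ≤ q ≤ N`).
Everything here is PROVED.

By partial summation with the decreasing weights `1/log n` the same bound (with another absolute
constant) holds for the UNWEIGHTED sum `P_N(α) = ∑_{p ≤ N} e(pα)` (written out as
`∑ p ∈ Nat.primesLE N, 𝐞(pα)`; as an object it is the tree's `Literature.Barriers.Parity.primeExpSumOne`,
`Literature/Barriers/Parity/CircleMethodBinary.lean`, not re-defined here):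
`P_N = T_N/log N + ∑_{2 ≤ n < N} T_n (1/log n - 1/log(n+1))` (`sum_primesLE_fourierChar_eq_abel`), whence
`‖P_N‖ ≤ max_{2 ≤ n ≤ N} ‖T_n‖ / log 2` (`norm_sum_primesLE_fourierChar_le_of_forall_le`); Vinogradov's bound
at the levels `q ≤ n ≤ N` and the trivial bound `‖T_n‖ ≤ θ(n) ≤ (log 4) n ≤ (log 4) √(Nq)` for
`n < q` give `vinogradov_sum_primesLE_fourierChar_bound`. On the minor arcs (Dirichlet's approximation,
`norm_oddPrimeExpSum_le_of_minor`) this is Pintz–Ruzsa's (2.9) with `N^{4/5}` added, unconditionally.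
Theorems only (no definitions). The last theorem, `norm_oddPrimeExpSum_le`, is the same
bound for `∑_{p ≤ N, p odd} e(pα)` — Pintz–Ruzsa's `S(α)` (*On Linnik's approximation to
Goldbach's problem, I*, Acta Arith. 109 (2003), (2.4); in the tree `GoldbachLinnik.primeSum N α`,
`GoldbachLinnikParseval.lean`), i.e. the unconditional (Vinogradov) replacement of their GRH
Lemma 2 used on the minor arcs in (10.6) of the proof of the Goldbach–Linnik theorem
(`Literature.NumberTheory.Sieve.goldbach_linnik`, parity.S36). The saving `1/log N` of the full
partial summation is not extracted (it is not needed there).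

## References

* M. B. Nathanson, *Additive Number Theory: The Classical Bases*, GTM 164 (1996), Thm 8.5 (p. 220).
  [Nathanson1996]
* J. Pintz, I. Z. Ruzsa, *On Linnik's approximation to Goldbach's problem, I*, Acta Arith. 109
  (2003) 169–194, §2 (2.4), Lemma 2, and (10.6). [PintzRuzsa2003]
-/

noncomputable section

open scoped FourierTransform

open Finset Filter

namespace Literature.NumberTheory.Sieve

namespace Vinogradov

/-! ### Partial summation from `∑ (log p) e(pα)` to `∑ e(pα)` -/

/-- `primeExpSumLog` as a sum over `range (N+1)`. [folklore] -/
theorem primeExpSumLog_eq_sum_range (N : ℕ) (α : ℝ) :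
    primeExpSumLog N α =
      ∑ n ∈ Finset.range (N + 1), if n.Prime then (Real.log n : ℂ) * (𝐞 ((n : ℝ) * α) : ℂ) else 0 := by
  rw [primeExpSumLog, Nat.primesLE_eq_filter_range, Finset.sum_filter]

/-- `∑_{p ≤ N} e(pα)` as a sum over `range (N+1)`. [folklore] -/
theorem sum_primesLE_fourierChar_eq_sum_range (N : ℕ) (α : ℝ) :
    (∑ p ∈ Nat.primesLE N, (𝐞 ((p : ℝ) * α) : ℂ)) = ∑ n ∈ Finset.range (N + 1), if n.Prime then (𝐞 ((n : ℝ) * α) : ℂ) else 0 := by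
  rw [Nat.primesLE_eq_filter_range, Finset.sum_filter]

/-- `T(0) = 0`, `T(1) = 0` for `T = primeExpSumLog`. [folklore] -/
theorem primeExpSumLog_one (α : ℝ) : primeExpSumLog 1 α = 0 := by
  rw [primeExpSumLog_eq_sum_range]
  simp [Finset.sum_range_succ, Nat.not_prime_zero, Nat.not_prime_one]

/-- **Abel summation identity**: for `N ≥ 2`, with `T(n) = ∑_{p ≤ n} (log p) e(pα)` and
`w(n) = 1/log n`,
`∑_{p ≤ N} e(pα) = T(N) w(N) + ∑_{2 ≤ n < N} T(n) (w(n) - w(n+1))`. [folklore] -/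
theorem sum_primesLE_fourierChar_eq_abel {N : ℕ} (hN : 2 ≤ N) (α : ℝ) :
    (∑ p ∈ Nat.primesLE N, (𝐞 ((p : ℝ) * α) : ℂ)) =
      primeExpSumLog N α * ((1 / Real.log N : ℝ) : ℂ) +
        ∑ n ∈ Finset.Ico 2 N, primeExpSumLog n α *
          (((1 / Real.log n : ℝ) : ℂ) - ((1 / Real.log ((n + 1 : ℕ) : ℝ) : ℝ) : ℂ)) := by
  induction N, hN using Nat.le_induction with
  | base =>
      rw [Finset.Ico_self, Finset.sum_empty, add_zero, sum_primesLE_fourierChar_eq_sum_range,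
        primeExpSumLog_eq_sum_range]
      simp only [Finset.sum_range_succ, Finset.sum_range_zero, Nat.not_prime_zero, Nat.not_prime_one,
        if_false, zero_add, Nat.prime_two, if_true]
      have hl : Real.log ((2 : ℕ) : ℝ) ≠ 0 := (Real.log_pos (by norm_num)).ne'
      rw [mul_comm ((Real.log ((2 : ℕ) : ℝ) : ℝ) : ℂ), mul_assoc, ← Complex.ofReal_mul,
        mul_one_div_cancel hl, Complex.ofReal_one, mul_one]
  | succ N hN ih =>
      -- `P(N+1) = P(N) + [N+1 prime] e((N+1)α)`, `T(N+1) = T(N) + [N+1 prime] log(N+1) e((N+1)α)`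
      have hP : (∑ p ∈ Nat.primesLE (N + 1), (𝐞 ((p : ℝ) * α) : ℂ)) = (∑ p ∈ Nat.primesLE N, (𝐞 ((p : ℝ) * α) : ℂ)) +
          (if (N + 1).Prime then (𝐞 (((N + 1 : ℕ) : ℝ) * α) : ℂ) else 0) := by
        rw [sum_primesLE_fourierChar_eq_sum_range, sum_primesLE_fourierChar_eq_sum_range, Finset.sum_range_succ]
      have hT : primeExpSumLog (N + 1) α = primeExpSumLog N α +
          (if (N + 1).Prime then (Real.log ((N + 1 : ℕ) : ℝ) : ℂ) * (𝐞 (((N + 1 : ℕ) : ℝ) * α) : ℂ) else 0) := by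
        rw [primeExpSumLog_eq_sum_range, primeExpSumLog_eq_sum_range, Finset.sum_range_succ]
      rw [Finset.sum_Ico_succ_top hN, hP, ih, hT]
      have hl : Real.log ((N + 1 : ℕ) : ℝ) ≠ 0 :=
        (Real.log_pos (by exact_mod_cast (show 1 < N + 1 by omega))).ne'
      have hlw : (Real.log ((N + 1 : ℕ) : ℝ) : ℂ) * ((1 / Real.log ((N + 1 : ℕ) : ℝ) : ℝ) : ℂ) = 1 := by
        rw [← Complex.ofReal_mul, mul_one_div_cancel hl, Complex.ofReal_one]
      split_ifs with hp
      · linear_combination (-(𝐞 (((N + 1 : ℕ) : ℝ) * α) : ℂ)) * hlw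
      · ring

/-- **Partial summation bound**: if `‖T(n)‖ ≤ M` for all `2 ≤ n ≤ N` (`N ≥ 2`), then
`‖∑_{p ≤ N} e(pα)‖ ≤ M/log 2` (the weights `1/log n` decrease, so the Abel sum telescopes).
[folklore] -/
theorem norm_sum_primesLE_fourierChar_le_of_forall_le {N : ℕ} (hN : 2 ≤ N) (α : ℝ) {M : ℝ}
    (hM : ∀ n, 2 ≤ n → n ≤ N → ‖primeExpSumLog n α‖ ≤ M) :
    ‖(∑ p ∈ Nat.primesLE N, (𝐞 ((p : ℝ) * α) : ℂ))‖ ≤ M / Real.log 2 := by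
  have hM0 : 0 ≤ M := (norm_nonneg _).trans (hM 2 le_rfl hN)
  rw [sum_primesLE_fourierChar_eq_abel hN]
  -- weights
  set w : ℕ → ℝ := fun n => 1 / Real.log (n : ℝ) with hw
  have hwpos : ∀ n : ℕ, 2 ≤ n → 0 < w n := fun n hn =>
    one_div_pos.mpr (Real.log_pos (by exact_mod_cast (show 1 < n by omega)))
  have hwanti : ∀ n : ℕ, 2 ≤ n → w (n + 1) ≤ w n := fun n hn => by
    simp only [hw]
    refine one_div_le_one_div_of_le (Real.log_pos (by exact_mod_cast (show 1 < n by omega)))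
      (Real.log_le_log (by positivity) ?_)
    push_cast
    linarith
  -- the telescoping sum of the weight differences
  have htel : ∀ K, 2 ≤ K → ∑ n ∈ Finset.Ico 2 K, (w n - w (n + 1)) = w 2 - w K := by
    intro K hK
    induction K, hK using Nat.le_induction with
    | base => simp
    | succ K hK ih => rw [Finset.sum_Ico_succ_top hK, ih]; ring
  have hfac : ∀ n : ℕ, (((1 / Real.log n : ℝ) : ℂ) - ((1 / Real.log ((n + 1 : ℕ) : ℝ) : ℝ) : ℂ)) =
      ((w n - w (n + 1) : ℝ) : ℂ) := fun n => by
    rw [Complex.ofReal_sub]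
  calc ‖primeExpSumLog N α * ((1 / Real.log N : ℝ) : ℂ) +
        ∑ n ∈ Finset.Ico 2 N, primeExpSumLog n α *
          (((1 / Real.log n : ℝ) : ℂ) - ((1 / Real.log ((n + 1 : ℕ) : ℝ) : ℝ) : ℂ))‖
      ≤ ‖primeExpSumLog N α * ((1 / Real.log N : ℝ) : ℂ)‖ +
          ∑ n ∈ Finset.Ico 2 N, ‖primeExpSumLog n α *
            (((1 / Real.log n : ℝ) : ℂ) - ((1 / Real.log ((n + 1 : ℕ) : ℝ) : ℝ) : ℂ))‖ :=
        (norm_add_le _ _).trans (add_le_add le_rfl (norm_sum_le _ _))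
    _ ≤ M * w N + ∑ n ∈ Finset.Ico 2 N, M * (w n - w (n + 1)) := by
        refine add_le_add ?_ (Finset.sum_le_sum fun n hn => ?_)
        · rw [norm_mul, Complex.norm_real, Real.norm_of_nonneg (hwpos N hN).le]
          exact mul_le_mul_of_nonneg_right (hM N hN le_rfl) (hwpos N hN).le
        · obtain ⟨h2, hnN⟩ := Finset.mem_Ico.mp hn
          have hdiff : 0 ≤ w n - w (n + 1) := sub_nonneg.mpr (hwanti n h2)
          rw [hfac n, norm_mul, Complex.norm_real, Real.norm_of_nonneg hdiff]
          exact mul_le_mul_of_nonneg_right (hM n h2 hnN.le) hdiff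
    _ = M * w 2 := by rw [← Finset.mul_sum, htel N hN]; ring
    _ = M / Real.log 2 := by simp only [hw]; push_cast; ring

/-! ### Vinogradov's bound for `∑_{p ≤ N} e(pα)` -/

/-- Trivial bound `‖T(n)‖ ≤ θ(n) ≤ log 4 · n`. [folklore] -/
theorem norm_primeExpSumLog_le_theta (n : ℕ) (α : ℝ) : ‖primeExpSumLog n α‖ ≤ Real.log 4 * n := by
  calc ‖primeExpSumLog n α‖ ≤ ∑ p ∈ Nat.primesLE n, ‖(Real.log p : ℂ) * (𝐞 ((p : ℝ) * α) : ℂ)‖ :=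
        norm_sum_le _ _
    _ = ∑ p ∈ Nat.primesLE n, Real.log p := by
        refine Finset.sum_congr rfl fun p hp => ?_
        have hp1 : (1 : ℝ) ≤ p := by exact_mod_cast (Nat.mem_primesLE.mp hp).2.one_le
        rw [norm_mul, Complex.norm_real, Real.norm_of_nonneg (Real.log_nonneg hp1), Circle.norm_coe, mul_one]
    _ = Chebyshev.theta n := (Chebyshev.theta_eq_sum_primesLE_log n).symm
    _ ≤ Real.log 4 * n := Chebyshev.theta_le_log4_mul_x (Nat.cast_nonneg n)

/-- **Vinogradov's estimate for the unweighted sum** (Nathanson's Thm 8.5 / Vaughan's proof, from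
the tree's `vinogradov_primeExpSumLog_bound` by partial summation): there is `C` such that for
`N ≥ 3`, `1 ≤ q ≤ N`, `(a, q) = 1`, `|α - a/q| ≤ 1/q²`,
`‖∑_{p ≤ N} e(pα)‖ ≤ C (N/√q + N^{4/5} + √N √q) (log N)⁴`.
(For `q ≤ n ≤ N` the weighted sums `T(n)` obey Vinogradov's bound at level `n ≤ N`; for `n < q`,
`‖T(n)‖ ≤ log 4 · n ≤ log 4 · √(Nq)`.) [cite: Nathanson1996, Theorem 8.5, p. 220] -/
theorem vinogradov_sum_primesLE_fourierChar_bound :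
    ∃ C : ℝ, ∀ (N : ℕ), 3 ≤ N → ∀ (α : ℝ) (a : ℤ) (q : ℕ), 1 ≤ q → q ≤ N →
      IsCoprime a (q : ℤ) → |α - a / q| ≤ 1 / (q : ℝ) ^ 2 →
        ‖(∑ p ∈ Nat.primesLE N, (𝐞 ((p : ℝ) * α) : ℂ))‖ ≤
          C * ((N : ℝ) / Real.sqrt q + (N : ℝ) ^ (4 / 5 : ℝ) + Real.sqrt N * Real.sqrt q) *
            Real.log N ^ 4 := by
  obtain ⟨C₀, hC₀⟩ := vinogradov_primeExpSumLog_bound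
  set C := max C₀ 0 with hC
  have hC0 : 0 ≤ C := le_max_right _ _
  refine ⟨(C + 2) / Real.log 2, fun N hN α a q hq hqN hcop hα => ?_⟩
  have hN2 : 2 ≤ N := by omega
  have hN1 : (1 : ℝ) < N := by exact_mod_cast (show 1 < N by omega)
  have hN0 : (0 : ℝ) < N := by linarith
  have hlogN1 : 1 ≤ Real.log N := by
    rw [← Real.log_exp 1]
    refine Real.log_le_log (Real.exp_pos 1) ?_
    have := Real.exp_one_lt_d9
    have h3 : (3 : ℝ) ≤ N := by exact_mod_cast hN
    linarith
  have hl2 : 0 < Real.log 2 := Real.log_pos one_lt_two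
  have hq0 : (0 : ℝ) < q := by exact_mod_cast hq
  set B : ℝ := (N : ℝ) / Real.sqrt q + (N : ℝ) ^ (4 / 5 : ℝ) + Real.sqrt N * Real.sqrt q with hB
  have hB0 : 0 ≤ B := by positivity
  have hBge : Real.sqrt N * Real.sqrt q ≤ B := by
    rw [hB]; have : 0 ≤ (N : ℝ) / Real.sqrt q + (N : ℝ) ^ (4 / 5 : ℝ) := by positivity
    linarith
  -- the bound `M` for all `T(n)`, `2 ≤ n ≤ N`
  have hM : ∀ n, 2 ≤ n → n ≤ N → ‖primeExpSumLog n α‖ ≤ (C + 2) * B * Real.log N ^ 4 := by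
    intro n hn2 hnN
    have hn0 : (0 : ℝ) < n := by exact_mod_cast (show 0 < n by omega)
    have hnN' : (n : ℝ) ≤ N := by exact_mod_cast hnN
    have hL4 : 1 ≤ Real.log N ^ 4 := one_le_pow₀ hlogN1
    rcases le_or_gt q n with hqn | hqn
    · -- Vinogradov at level `n`
      have hV := hC₀ n hn2 α a q hq hqn hcop hα
      have hlogn : Real.log n ≤ Real.log N := Real.log_le_log hn0 hnN'
      have hlogn0 : 0 ≤ Real.log n := Real.log_nonneg (by exact_mod_cast (show 1 ≤ n by omega))
      have hBn : (n : ℝ) / Real.sqrt q + (n : ℝ) ^ (4 / 5 : ℝ) + Real.sqrt n * Real.sqrt q ≤ B := by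
        rw [hB]
        gcongr
      have hBn0 : 0 ≤ (n : ℝ) / Real.sqrt q + (n : ℝ) ^ (4 / 5 : ℝ) + Real.sqrt n * Real.sqrt q := by
        positivity
      calc ‖primeExpSumLog n α‖
          ≤ C₀ * ((n : ℝ) / Real.sqrt q + (n : ℝ) ^ (4 / 5 : ℝ) + Real.sqrt n * Real.sqrt q) * Real.log n ^ 4 := hV
        _ ≤ C * ((n : ℝ) / Real.sqrt q + (n : ℝ) ^ (4 / 5 : ℝ) + Real.sqrt n * Real.sqrt q) * Real.log n ^ 4 := by
            gcongr; exact le_max_left _ _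
        _ ≤ C * B * Real.log N ^ 4 := by
            gcongr
        _ ≤ (C + 2) * B * Real.log N ^ 4 := by gcongr; linarith
    · -- `n < q`: trivial bound
      have h1 := norm_primeExpSumLog_le_theta n α
      have hl4 : Real.log 4 < 2 := by
        have := Real.log_two_lt_d9
        rw [show (4 : ℝ) = 2 ^ 2 by norm_num, Real.log_pow]; push_cast; linarith
      have hnq : (n : ℝ) ≤ Real.sqrt N * Real.sqrt q := by
        rw [← Real.sqrt_mul hN0.le]
        refine Real.le_sqrt_of_sq_le ?_
        have hnq' : (n : ℝ) ≤ q := by exact_mod_cast hqn.le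
        nlinarith
      calc ‖primeExpSumLog n α‖ ≤ Real.log 4 * n := h1
        _ ≤ 2 * B := by nlinarith [hBge]
        _ ≤ (C + 2) * B * Real.log N ^ 4 := by nlinarith [mul_nonneg hC0 hB0, mul_nonneg hB0 (sub_nonneg.mpr hL4)]
  have h := norm_sum_primesLE_fourierChar_le_of_forall_le hN2 α hM
  calc ‖(∑ p ∈ Nat.primesLE N, (𝐞 ((p : ℝ) * α) : ℂ))‖ ≤ (C + 2) * B * Real.log N ^ 4 / Real.log 2 := h
    _ = (C + 2) / Real.log 2 * B * Real.log N ^ 4 := by ring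

/-! ### The odd-prime sum `S(α)` of Pintz–Ruzsa -/

/-- **Vinogradov's estimate for Pintz–Ruzsa's `S(α) = ∑_{p ≤ N, p odd} e(pα)`** (the unconditional
replacement of their GRH Lemma 2 on the minor arcs): there is `C` such that for `N ≥ 3`,
`1 ≤ q ≤ N`, `(a, q) = 1`, `|α - a/q| ≤ 1/q²`,
`‖∑_{p ∈ GoldbachLinnik.oddPrimes N} e(pα)‖ ≤ C (N/√q + N^{4/5} + √N √q) (log N)⁴`
(the sum is `GoldbachLinnik.primeSum N α` of `GoldbachLinnikParseval.lean`; it differs from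
`(∑ p ∈ Nat.primesLE N, (𝐞 ((p : ℝ) * α) : ℂ))` by the single term `e(2α)`). [cite: PintzRuzsa2003, §2 Lemma 2 (unconditional analogue: Vinogradov)]
[cite: Nathanson1996, Theorem 8.5, p. 220] -/
theorem norm_oddPrimeExpSum_le :
    ∃ C : ℝ, ∀ (N : ℕ), 3 ≤ N → ∀ (α : ℝ) (a : ℤ) (q : ℕ), 1 ≤ q → q ≤ N →
      IsCoprime a (q : ℤ) → |α - a / q| ≤ 1 / (q : ℝ) ^ 2 →
        ‖∑ p ∈ GoldbachLinnik.oddPrimes N, (𝐞 ((p : ℝ) * α) : ℂ)‖ ≤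
          C * ((N : ℝ) / Real.sqrt q + (N : ℝ) ^ (4 / 5 : ℝ) + Real.sqrt N * Real.sqrt q) *
            Real.log N ^ 4 := by
  obtain ⟨C, hC⟩ := vinogradov_sum_primesLE_fourierChar_bound
  refine ⟨C + 1, fun N hN α a q hq hqN hcop hα => ?_⟩
  have h := hC N hN α a q hq hqN hcop hα
  have hN1 : (1 : ℝ) < N := by exact_mod_cast (show 1 < N by omega)
  have hN0 : (0 : ℝ) < N := by linarith
  have hlogN1 : 1 ≤ Real.log N := by
    rw [← Real.log_exp 1]
    refine Real.log_le_log (Real.exp_pos 1) ?_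
    have := Real.exp_one_lt_d9
    have h3 : (3 : ℝ) ≤ N := by exact_mod_cast hN
    linarith
  -- `∑_{odd primes} = ∑_{primes} - e(2α)`
  have hsplit : ∑ p ∈ GoldbachLinnik.oddPrimes N, (𝐞 ((p : ℝ) * α) : ℂ) =
      (∑ p ∈ Nat.primesLE N, (𝐞 ((p : ℝ) * α) : ℂ)) - (𝐞 (((2 : ℕ) : ℝ) * α) : ℂ) := by
    have hset : GoldbachLinnik.oddPrimes N = (Nat.primesLE N).erase 2 := by
      ext p
      rw [GoldbachLinnik.mem_oddPrimes, Finset.mem_erase, Nat.mem_primesLE]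
      constructor
      · rintro ⟨hpN, hp, hodd⟩
        refine ⟨?_, hpN, hp⟩
        rintro rfl
        exact (Nat.not_even_iff_odd.mpr hodd) even_two
      · rintro ⟨hp2, hpN, hp⟩
        exact ⟨hpN, hp, hp.odd_of_ne_two hp2⟩
    have h2mem : 2 ∈ Nat.primesLE N := Nat.mem_primesLE.mpr ⟨by omega, Nat.prime_two⟩
    rw [hset, ← Finset.sum_erase_add _ _ h2mem]
    ring
  rw [hsplit]
  have hB1 : 1 ≤ ((N : ℝ) / Real.sqrt q + (N : ℝ) ^ (4 / 5 : ℝ) + Real.sqrt N * Real.sqrt q) * Real.log N ^ 4 := by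
    have h45 : (1 : ℝ) ≤ (N : ℝ) ^ (4 / 5 : ℝ) := Real.one_le_rpow hN1.le (by norm_num)
    have h0 : 0 ≤ (N : ℝ) / Real.sqrt q + Real.sqrt N * Real.sqrt q := by positivity
    have hL4 : 1 ≤ Real.log N ^ 4 := one_le_pow₀ hlogN1
    nlinarith
  calc ‖(∑ p ∈ Nat.primesLE N, (𝐞 ((p : ℝ) * α) : ℂ)) - (𝐞 (((2 : ℕ) : ℝ) * α) : ℂ)‖
      ≤ ‖(∑ p ∈ Nat.primesLE N, (𝐞 ((p : ℝ) * α) : ℂ))‖ + ‖(𝐞 (((2 : ℕ) : ℝ) * α) : ℂ)‖ := norm_sub_le _ _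
    _ = ‖(∑ p ∈ Nat.primesLE N, (𝐞 ((p : ℝ) * α) : ℂ))‖ + 1 := by rw [Circle.norm_coe]
    _ ≤ C * ((N : ℝ) / Real.sqrt q + (N : ℝ) ^ (4 / 5 : ℝ) + Real.sqrt N * Real.sqrt q) * Real.log N ^ 4 + 1 := by
        linarith
    _ ≤ (C + 1) * ((N : ℝ) / Real.sqrt q + (N : ℝ) ^ (4 / 5 : ℝ) + Real.sqrt N * Real.sqrt q) * Real.log N ^ 4 := by
        nlinarith

/-! ### On the minor arcs -/

/-- **Pintz–Ruzsa's (2.9), unconditionally (Vinogradov on the minor arcs).** There is `C` such that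
for `N ≥ 3`, `1 ≤ P ≤ Q ≤ N` and every `α` outside the major arcs of level `P` and width `1/(qQ)`
— i.e. `|α - a/q| > 1/(qQ)` for all `a` and all `1 ≤ q ≤ P` — one has
`‖∑_{p ≤ N, p odd} e(pα)‖ ≤ C (N/√P + N^{4/5} + √N √Q) (log N)⁴`
(Dirichlet: `|α - a/q| ≤ 1/((⌊Q⌋+1) q) < 1/(qQ)` with `q ≤ Q` in lowest terms, so `q > P`, then
`norm_oddPrimeExpSum_le`). Pintz–Ruzsa (GRH, Lemma 2 = Baker–Harman Lemma 12): `≪ (N/√P + √(NQ) + N√Q/P … ) L²`;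
with `P = N^{2/5}`, `Q = N^{3/5}` both give `N^{4/5} log^c N`. [cite: PintzRuzsa2003, §2 Lemma 2 and (2.9)–(2.10)]
[cite: Nathanson1996, Theorem 8.5, p. 220] -/
theorem norm_oddPrimeExpSum_le_of_minor :
    ∃ C : ℝ, ∀ (N : ℕ), 3 ≤ N → ∀ (P Q : ℝ), 1 ≤ P → P ≤ Q → Q ≤ N → ∀ α : ℝ,
      (∀ (a : ℤ) (q : ℕ), 1 ≤ q → (q : ℝ) ≤ P → 1 / ((q : ℝ) * Q) < |α - a / q|) →
        ‖∑ p ∈ GoldbachLinnik.oddPrimes N, (𝐞 ((p : ℝ) * α) : ℂ)‖ ≤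
          C * ((N : ℝ) / Real.sqrt P + (N : ℝ) ^ (4 / 5 : ℝ) + Real.sqrt N * Real.sqrt Q) *
            Real.log N ^ 4 := by
  obtain ⟨C₀, hC₀⟩ := norm_oddPrimeExpSum_le
  set C := max C₀ 0 with hC
  have hC0 : 0 ≤ C := le_max_right _ _
  refine ⟨C, fun N hN P Q hP hPQ hQN α hminor => ?_⟩
  have hQ1 : 1 ≤ Q := hP.trans hPQ
  have hQ0 : 0 < Q := by linarith
  have hP0 : 0 < P := by linarith
  set n := ⌊Q⌋₊ with hn
  have hnpos : 0 < n := Nat.floor_pos.mpr hQ1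
  have hnQ : (n : ℝ) ≤ Q := Nat.floor_le hQ0.le
  have hQn : Q < n + 1 := Nat.lt_floor_add_one Q
  obtain ⟨r, hr, hden⟩ := Real.exists_rat_abs_sub_le_and_den_le α hnpos
  set q : ℕ := r.den with hq
  set a : ℤ := r.num with ha
  have hq1 : 1 ≤ q := r.den_pos
  have hq0 : (0 : ℝ) < q := by exact_mod_cast r.den_pos
  have hrq : (r : ℝ) = (a : ℝ) / q := by rw [ha, hq]; exact_mod_cast r.num_div_den.symm
  rw [hrq] at hr
  have hqn : (q : ℝ) ≤ n := by exact_mod_cast hden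
  -- `|α - a/q| < 1/(qQ)` and `≤ 1/q²`
  have hlt : |α - a / q| < 1 / ((q : ℝ) * Q) := by
    calc |α - a / q| ≤ 1 / ((n + 1) * (q : ℝ)) := by simpa [hq] using hr
      _ < 1 / ((q : ℝ) * Q) := by
          rw [one_div_lt_one_div (by positivity) (by positivity)]
          nlinarith
  have hle : |α - a / q| ≤ 1 / (q : ℝ) ^ 2 := by
    calc |α - a / q| ≤ 1 / ((n + 1) * (q : ℝ)) := by simpa [hq] using hr
      _ ≤ 1 / (q : ℝ) ^ 2 := by
          rw [one_div_le_one_div (by positivity) (by positivity), sq]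
          nlinarith
  -- hence `q > P`
  have hPq : P < q := by
    by_contra hcon
    push Not at hcon
    have := hminor a q hq1 hcon
    linarith
  have hqN : q ≤ N := by
    have : (q : ℝ) ≤ N := hqn.trans (hnQ.trans hQN)
    exact_mod_cast this
  have hcop : IsCoprime a (q : ℤ) := by
    rw [Int.isCoprime_iff_gcd_eq_one, ha, hq]
    exact_mod_cast r.reduced
  have h := hC₀ N hN α a q hq1 hqN hcop hle
  have hN0 : (0 : ℝ) < N := by exact_mod_cast (show 0 < N by omega)
  -- compare the two brackets
  have h1 : (N : ℝ) / Real.sqrt q ≤ (N : ℝ) / Real.sqrt P :=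
    div_le_div_of_nonneg_left hN0.le (Real.sqrt_pos.mpr hP0) (Real.sqrt_le_sqrt hPq.le)
  have h2 : Real.sqrt N * Real.sqrt q ≤ Real.sqrt N * Real.sqrt Q :=
    mul_le_mul_of_nonneg_left (Real.sqrt_le_sqrt (hqn.trans hnQ)) (Real.sqrt_nonneg _)
  have hlog0 : 0 ≤ Real.log N ^ 4 := by positivity
  calc ‖∑ p ∈ GoldbachLinnik.oddPrimes N, (𝐞 ((p : ℝ) * α) : ℂ)‖
      ≤ C₀ * ((N : ℝ) / Real.sqrt q + (N : ℝ) ^ (4 / 5 : ℝ) + Real.sqrt N * Real.sqrt q) * Real.log N ^ 4 := h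
    _ ≤ C * ((N : ℝ) / Real.sqrt q + (N : ℝ) ^ (4 / 5 : ℝ) + Real.sqrt N * Real.sqrt q) * Real.log N ^ 4 := by
        gcongr
        exact le_max_left _ _
    _ ≤ C * ((N : ℝ) / Real.sqrt P + (N : ℝ) ^ (4 / 5 : ℝ) + Real.sqrt N * Real.sqrt Q) * Real.log N ^ 4 := by
        gcongr

end Vinogradov

end Literature.NumberTheory.Sieve

end
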